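import Summits.QuantumFields.YangMills.Theorems.BalabanUVNodesN22AtRecordStrip
import Summits.QuantumFields.YangMills.Theorems.BalabanUVNodesN22AtRecordAnalytic

/-!
# BalabanUVNodes ∕ node N22 = NE9 AT A TOWER-KEYED RATE RECORD — the K4-internal edge N18 → N22 AT STUB LEVEL: `S_N18 RRec → S_N22 RRec`
# for EVERY rate-record predicate `RRec` that keys its U3 bundles as LEVELS OF ONE TOWER OF CARRIERS (lower levels again bundles of record),
# modulo the displayed regularity letter, in the three currencies of record ((R₂) second differences ∕ (A′) derivative letter ∕ (A) sup letter);
# K4's join at such a home with N22's binder REPLACED by the letter; a model record showing the key is inhabited (plan word (W2); count-neutral)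

Cell `pub-ymgap`, HUMAN RULING D-0062 (Track A at full width), seat `pub-ymgap-dag-n22-e` (R134 acceleration seat, strategy s2 = by-name knit
at the ₁₁ record), generation 0.  THEOREMS ONLY (no `def`, no `def … : Prop`); imports the -a seat's AT-RECORD closers of record
(`BalabanUVNodesN22AtRecord` p419962 ⊆ `…AtRecordStrip` p428115, `…AtRecordAnalytic` p421057 + p425325) and through them the route's K4 module
`BalabanUVNodesSpineRates` (`U3Carriers`, `RateCarriers`, `RateRecordPred`, `N18At`, `N22At`, `S_N18`, `S_N22`, `S_D4`, `S_N17`, `N17_of_U3edge`,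
`SpineRates_of_glueN17`).  `--supports stmt-QuantumFields-19676` (K3 `SpineGivenEndpointR11`; the spine side).

WHY THIS FILE (pub-ymgap INBOX [DAGN22E-G0-LOCATED-1] ∕ [DAGN22E-G0-DESIGN-INPUT-RR] (H2), 2026-08-26).  The RATE-RECORD HOME keyed to NODE 00's
Stage-11 record (`Node00.IsRecordOfRecord₁₁C`, `Node00/Record11.lean` p444286) — a CONCRETE `RRec₁₁ : RateRecordPred N` — does not exist yet
(definer seats `pub-ymgap-node00-def-RR-1∕-RR-2`, director-ym R141 (A)); N22's statement `N22At R.u3` reads no field of the datum, so every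
₁₁-keyed closer typed before the U3 carriers of record are DEFINED would carry an idle record clause.  What IS typable now, and what the home
will instantiate in ONE application, is the K4-internal edge N18 → N22 AT STUB LEVEL.  In the tree the edge exists only INSIDE a slot —
`YMDAG.N22.n22At_level_of_n18At_below{,_strip,_analytic}` display `N18At` at every lower level as a hypothesis of the slot — and at stub level only
for N17 (`YMDAG.UVSplit.N17_of_U3edge : S_D4 → S_N18 → S_N22 → S_N17`).  Here: if `RRec` is TOWER-KEYED — every U3 bundle of record is a level
`k` of ONE tower of carriers `T` with level functionals `E` (`EA = E k`, `EB b = E (k+1) ∘ prepend b`), and every LOWER level `k′ < k` of that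
tower is again the U3 bundle of some record of the SAME `(F, D, g₀, os)` (with any history letters) — then node N18's stub `S_N18 RRec` supplies
the oscillation-fading input (O) at every lower level BY NAME, and `S_N22 RRec` follows from (P) prefix dependence + ONE regularity letter at
the bundle's level.  So at a tower-keyed home K4 has SIX binders (R00x, N14, N15, N16, N18, D4) plus N22's LETTER — nothing else of N22 remains.

WHAT.
* §1 `n18At_congr_letters` (`N18At` reads only `(C, W, γ, κ, EA, EB, θ, C₅)`: bundle literals differing in the history letters `(Λ, C₉, ω, cr, ρ)`
  carry the same `N18At`, `Iff.rfl`); `n18At_below_of_s_N18` (from `S_N18 RRec` and the tower key of the lower levels, the `h18` clause of the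
  -a slots at ANY target letters).
* §2 THE EDGE, three currencies: **`s_N22_of_s_N18_towerKeyed`** ((R₂): second differences `≤ M·μ^{age−1}·e^{−κd}·d²`, letters
  `Λ a i = C₉·τ^{a−i}`, `C₉ = (4·(2C₅∕(1−θ))∕γ + Mγ∕2)∕τ`, `θ ≤ τρ`, `μρ ≤ τ`; via `n22At_level_of_n18At_below`),
  `s_N22_of_s_N18_towerKeyed_strip` ((A′): ONE complex-differentiable extension per young-coupling section on a set containing the open
  `r`-discs about the window with a DERIVATIVE letter `L·μ^{age−1}·e^{−κd}`, rate `θ^{1−s}μ^{s}`; via `n22At_level_of_n18At_below_strip`),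
  `s_N22_of_s_N18_towerKeyed_analytic` ((A): sup letter `M·μ^{age−1}·e^{−κd}` on closed `r`-discs; via `n22At_level_of_n18At_below_analytic`).
* §3 K4 AT A TOWER-KEYED HOME: `s_N17_of_s_N18_towerKeyed` (`S_D4 → S_N18 → key → S_N17`), **`spineRates_of_towerKeyed_glueN17`**
  (`S_R00x → S_N14 → S_N15 → S_N16 → S_N18 → key → S_D4 → SpineRates Rec (RateInputs RRec)`, `SpineRates_of_glueN17` with its `h22` DERIVED).
* §4 NON-VACUITY OF THE KEY (referee standard A5): for EVERY tower `T`, the MODEL predicate «`R.u3` is a level of `T` with ZERO functionals and the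
  §2 letters at `C₅ = 1`, `θ = 1∕2`, `γ = 1`, `M = μ = 0`, `ρ = 1`, `τ = 1∕2`» carries `S_N18` (`s_N18_toyTowerRecord`) and is tower-keyed, hence
  carries `S_N22` by §2 (`s_N22_toyTowerRecord`) — a MODEL record, NOT NODE 00's; it shows the key + the letter + `S_N18` are jointly satisfiable
  and that §2 fires by `exact`.

HONEST FRAMING.  Count-neutral kernel bookkeeping BY NAME; NOT a discharge of N22 (no `RRec` home; the regularity letter — (R₂)∕(A′)∕(A) localized
with `e^{−κd_j(X)}` per domain — is the object W1 of [Balaban1988RG2Cluster] §§1–2 + the un-printed history estimate, displayed here as a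
hypothesis; the tower key is the home's DESIGN (H2), displayed likewise); NE5 ∕ NE9 NOT IN PRINT ([Balaban1987RG1] p. 263 gives only *«It is a
C^∞-function of g_{j−1} ∈ [0, γ], (or analytic)»*, pp. 256 ∕ 298 the dependence on the preceding couplings) and NOT PROVED; instance on Bałaban's
localized `E^{(j)}(X; g⃗, U)` 0∕1.  One finite four-torus programme at fixed ε — NOT infinite volume, NOT OS on ℝ⁴, NOT a mass gap, NOT Clay.
0 `sorry`, 0 `def`, standard axioms.

References (TYPES only): [Balaban1987RG1] = T. Bałaban, Commun. Math. Phys. **109** (1987) 249–301 — p. 256 (prefix dependence, words),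
Thm 1 p. 259, (1.18) and the C^∞ clause p. 263, p. 298; [Balaban1988RG2Cluster] = T. Bałaban, Commun. Math. Phys. **116** (1988) 1–22 —
§§1–2, (2.40)–(2.41) p. 21 (the localized decay bound, NOT a history estimate).
-/

noncomputable section

namespace YMDAG.N22

open Set Metric
open scoped BigOperators
open Literature.MathematicalPhysics.QuantumFieldTheory.Balaban1983to89
open Literature.MathematicalPhysics.QuantumFieldTheory.Balaban1983to89.T4Continuum
open Literature.MathematicalPhysics.QuantumFieldTheory.Balaban1983to89.T4OutputRate
open Summit.QuantumFields.BalabanUV.T4Continuum.NE9.TowerCarriers (TowerData prepend)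
open YMDAG.UVSplit

variable {N : ℕ} [NeZero N]

/-! ## §1 Node N18's stub at the lower levels of a tower-keyed record -/

/-- **`N18At` DOES NOT READ THE HISTORY LETTERS** (`Iff.rfl`): two U3 bundle literals with the same `(C, W, γ, κ, EA, EB, θ, C₅)` and any history
moduli ∕ fading letters ∕ read-out letters `(Λ, C₉, ω, cr, ρ)` carry the same `N18At` — so node N18's stub at a lower-level bundle of record serves
the `h18` clause of every N22 tower slot, whatever letters that slot names. [folklore] -/
theorem n18At_congr_letters (C : Carriers) (W : Set (ℕ → ℝ)) (γ κ : ℝ) (EA : Functional C C.BgA) (EB : ℝ → Functional C C.BgB)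
    (θ C₅ : ℝ) (Λ Λ' : ℕ → ℕ → ℝ) (C₉ ω cr ρ C₉' ω' cr' ρ' : ℝ) :
    N18At ⟨C, W, γ, κ, EA, EB, θ, C₅, Λ, C₉, ω, cr, ρ⟩ ↔ N18At ⟨C, W, γ, κ, EA, EB, θ, C₅, Λ', C₉', ω', cr', ρ'⟩ :=
  Iff.rfl

/-- **NODE N18 BELOW THE LEVEL, FROM ITS STUB AND THE TOWER KEY.**  If `S_N18 RRec` and every lower level `k′ < k` of the tower `(T, E)` (window
`Window γ`, decay `κ`, NE5 letters `θ, C₅`) is the U3 bundle of SOME record `R′` of `(F, D, g₀, os)` under `RRec` — with ANY history letters — then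
`N18At` holds at every lower-level bundle literal, at any target letters `(Λ, C₉, ω, cr, ρ)`: the `h18` clause of
`YMDAG.N22.n22At_level_of_n18At_below{,_strip,_analytic}`. [folklore] -/
theorem n18At_below_of_s_N18 {RRec : RateRecordPred N} (h18 : S_N18 RRec) {F : T4Family} {D : Datum F N} {g₀ : ℕ → ℝ}
    {os : List (ULoop F)} (T : TowerData) (E : ℕ → (ℕ → ℝ) → T.B → T.Dom → ℝ) (γ κ θ C₅ : ℝ) (Λ : ℕ → ℕ → ℝ) (C₉ ω cr ρ : ℝ)
    {k : ℕ}
    (hlow : ∀ k' < k, ∃ (R' : RateCarriers N) (Λ' : ℕ → ℕ → ℝ) (C₉' ω' cr' ρ' : ℝ), RRec F D g₀ os R' ∧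
      R'.u3 = ⟨T.level k', Window γ, γ, κ, E k', fun b g U X => E (k' + 1) (prepend b g) U X, θ, C₅, Λ', C₉', ω', cr', ρ'⟩) :
    ∀ k' : ℕ, k' < k →
      N18At ⟨T.level k', Window γ, γ, κ, E k', fun b g U X => E (k' + 1) (prepend b g) U X, θ, C₅, Λ, C₉, ω, cr, ρ⟩ := by
  intro k' hk'
  obtain ⟨R', Λ', C₉', ω', cr', ρ', hR', hu⟩ := hlow k' hk'
  have h : N18At R'.u3 := h18 F D g₀ os R' hR'
  rw [hu] at h
  exact (n18At_congr_letters _ _ _ _ _ _ _ _ Λ' Λ C₉' ω' cr' ρ' C₉ ω cr ρ).mp h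

/-! ## §2 The edge N18 → N22 at STUB level for every tower-keyed rate record, three currencies -/

/-- **`S_N18 RRec → S_N22 RRec` AT A TOWER-KEYED RATE RECORD — SECOND-DIFFERENCE CURRENCY (R₂).**  Suppose every U3 bundle of record is level `k`
of ONE tower of carriers `T` with level functionals `E` (`EA = E k`, run B's family `EB b = E (k+1) ∘ prepend b`), window `Window γ`, NE5 letters
`0 ≤ C₅`, `0 ≤ θ < 1`, history letters `Λ a i = C₉·τ^{a−i}`, `C₉ = (4·(2C₅∕(1−θ))∕γ + Mγ∕2)∕τ`, fading letter `τ`; every LOWER level `k′ < k` is the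
U3 bundle of some record of the same `(F, D, g₀, os)`; and `E k` has (P) prefix dependence and the letter (R₂) — second differences of every
young-coupling section bounded by `M·μ^{age−1}·e^{−κd(X)}·d²` — with `0 < ρ ≤ 1`, `θ ≤ τρ`, `μρ ≤ τ`, `τ > 0`.  Then node N18's stub gives node
N22's: the oscillation input (O) at the lower levels is `S_N18 RRec` BY NAME (§1), the rest is `YMDAG.N22.n22At_level_of_n18At_below`
(`N22KnitFiniteTower.ne9_fadingMemory_at_level_of_ne5_below`).  The letter and the key are DISPLAYED hypotheses. [folklore] -/
theorem s_N22_of_s_N18_towerKeyed (RRec : RateRecordPred N) (h18 : S_N18 RRec)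
    (hkey : ∀ (F : T4Family) (D : Datum F N) (g₀ : ℕ → ℝ) (os : List (ULoop F)) (R : RateCarriers N), RRec F D g₀ os R →
      ∃ (T : TowerData) (E : ℕ → (ℕ → ℝ) → T.B → T.Dom → ℝ) (γ κ θ C₅ M μ ρ τ cr ρ' : ℝ) (k : ℕ),
        R.u3 = ⟨T.level k, Window γ, γ, κ, E k, fun b g U X => E (k + 1) (prepend b g) U X, θ, C₅,
          fun a i => (4 * (2 * C₅ / (1 - θ)) / γ + M * γ / 2) / τ * τ ^ (a - i), (4 * (2 * C₅ / (1 - θ)) / γ + M * γ / 2) / τ, τ, cr, ρ'⟩ ∧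
        0 ≤ C₅ ∧ 0 ≤ θ ∧ θ < 1 ∧
        (∀ k' < k, ∃ (R' : RateCarriers N) (Λ' : ℕ → ℕ → ℝ) (C₉' ω' cr' ρ'' : ℝ), RRec F D g₀ os R' ∧
          R'.u3 = ⟨T.level k', Window γ, γ, κ, E k', fun b g U X => E (k' + 1) (prepend b g) U X, θ, C₅, Λ', C₉', ω', cr', ρ''⟩) ∧
        PrefixDependenceOn (C := T.level k) (E k) (Window γ) ∧
        (∀ g ∈ Window γ, ∀ (U : (T.level k).BgA) (X : (T.level k).Dom) (i : ℕ), i < (T.level k).scale X →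
          ∀ t d : ℝ, 0 < d → t - d ∈ Ioc (0 : ℝ) γ → t + d ∈ Ioc (0 : ℝ) γ →
            |E k (Function.update g i (t + d)) U X - 2 * E k (Function.update g i t) U X + E k (Function.update g i (t - d)) U X| ≤
              M * μ ^ ((T.level k).scale X - 1 - i) * Real.exp (-(κ * (T.level k).d X)) * d ^ 2) ∧
        0 ≤ M ∧ 0 ≤ μ ∧ 0 < γ ∧ 0 < ρ ∧ ρ ≤ 1 ∧ θ ≤ τ * ρ ∧ μ * ρ ≤ τ ∧ 0 < τ) :
    S_N22 RRec := by
  intro F D g₀ os R hR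
  obtain ⟨T, E, γ, κ, θ, C₅, M, μ, ρ, τ, cr, ρ', k, hu, hC, hθ0, hθ1, hlow, hP, hR2, hM, hμ, hγ, hρ0, hρ1, hθτρ, hμρτ, hτ0⟩ :=
    hkey F D g₀ os R hR
  rw [hu]
  exact n22At_level_of_n18At_below T E hC hθ0 hθ1 k (n18At_below_of_s_N18 h18 T E γ κ θ C₅ _ _ _ _ _ hlow) hP hR2 hM hμ hγ hρ0
    hρ1 hθτρ hμρτ hτ0

/-- **`S_N18 RRec → S_N22 RRec` AT A TOWER-KEYED RATE RECORD — DERIVATIVE-LETTER CURRENCY (A′)** (ROAD 3 in the strip currency, the output shape of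
`B12Eq213AnalyticHistory.analyticHistory_letters` on the (2.13) body): the key as in `s_N22_of_s_N18_towerKeyed` with the strip-road letters
(`ω = θ^{1−s}μ^{s}`, `Λ a i = C₉·ω^{a−i}`, `C₉ = (32∕(s²·min(r∕2, γ∕2)))·(2C₅∕(1−θ))^{1−s}(2Lr)^{s}∕ω`), `0 < C₅`, `0 < θ < 1`, and at the bundle's
level (P) + (A′): ONE complex-differentiable extension per young-coupling section on a set containing the open `r`-discs about `]0, γ]` with the
derivative letter `L·μ^{age−1}·e^{−κd}` (`θ ≤ μ`, `2C₅∕(1−θ) ≤ 2Lr`, `0 < s < 1`) — via `YMDAG.N22.n22At_level_of_n18At_below_strip`; fading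
(`ω < 1`) is the home's choice of `s` (`YMDAG.N22.exists_fading_rate`). [folklore] -/
theorem s_N22_of_s_N18_towerKeyed_strip (RRec : RateRecordPred N) (h18 : S_N18 RRec)
    (hkey : ∀ (F : T4Family) (D : Datum F N) (g₀ : ℕ → ℝ) (os : List (ULoop F)) (R : RateCarriers N), RRec F D g₀ os R →
      ∃ (T : TowerData) (E : ℕ → (ℕ → ℝ) → T.B → T.Dom → ℝ) (γ κ θ C₅ L μ r s cr ρ' : ℝ) (k : ℕ),
        R.u3 = ⟨T.level k, Window γ, γ, κ, E k, fun b g U X => E (k + 1) (prepend b g) U X, θ, C₅,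
          fun a i => 32 / (s ^ 2 * min (r / 2) (γ / 2)) * ((2 * C₅ / (1 - θ)) ^ (1 - s) * (2 * (L * r)) ^ s) / (θ ^ (1 - s) * μ ^ s)
            * (θ ^ (1 - s) * μ ^ s) ^ (a - i),
          32 / (s ^ 2 * min (r / 2) (γ / 2)) * ((2 * C₅ / (1 - θ)) ^ (1 - s) * (2 * (L * r)) ^ s) / (θ ^ (1 - s) * μ ^ s),
          θ ^ (1 - s) * μ ^ s, cr, ρ'⟩ ∧
        0 < C₅ ∧ 0 < θ ∧ θ < 1 ∧
        (∀ k' < k, ∃ (R' : RateCarriers N) (Λ' : ℕ → ℕ → ℝ) (C₉' ω' cr' ρ'' : ℝ), RRec F D g₀ os R' ∧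
          R'.u3 = ⟨T.level k', Window γ, γ, κ, E k', fun b g U X => E (k' + 1) (prepend b g) U X, θ, C₅, Λ', C₉', ω', cr', ρ''⟩) ∧
        PrefixDependenceOn (C := T.level k) (E k) (Window γ) ∧
        (∀ g ∈ Window γ, ∀ (U : (T.level k).BgA) (X : (T.level k).Dom) (i : ℕ), i < (T.level k).scale X →
          ∃ (Fz : ℂ → ℂ) (Dset : Set ℂ), DifferentiableOn ℂ Fz Dset ∧
            (∀ z ∈ Dset, ‖deriv Fz z‖ ≤ L * μ ^ ((T.level k).scale X - 1 - i) * Real.exp (-(κ * (T.level k).d X))) ∧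
            (∀ t ∈ Ioc (0 : ℝ) γ, ball (t : ℂ) r ⊆ Dset) ∧
            (∀ t ∈ Ioc (0 : ℝ) γ, Fz t = (E k (Function.update g i t) U X : ℂ))) ∧
        0 < L ∧ θ ≤ μ ∧ 2 * C₅ / (1 - θ) ≤ 2 * (L * r) ∧ 0 < r ∧ 0 < γ ∧ 0 < s ∧ s < 1) :
    S_N22 RRec := by
  intro F D g₀ os R hR
  obtain ⟨T, E, γ, κ, θ, C₅, L, μ, r, s, cr, ρ', k, hu, hC, hθ0, hθ1, hlow, hP, hA, hL, hθμ, hCL, hr, hγ, hs0, hs1⟩ :=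
    hkey F D g₀ os R hR
  rw [hu]
  exact n22At_level_of_n18At_below_strip T E hC hθ0 hθ1 k (n18At_below_of_s_N18 h18 T E γ κ θ C₅ _ _ _ _ _ hlow) hP hA hL hθμ
    hCL hr hγ hs0 hs1

/-- **`S_N18 RRec → S_N22 RRec` AT A TOWER-KEYED RATE RECORD — SUP-LETTER CURRENCY (A)** (ROAD 3's uniform-margin analyticity, printed TYPE
«(or analytic)» [Balaban1987RG1] p. 263 for the last coupling): the key as in `s_N22_of_s_N18_towerKeyed` with the ROAD-3 letters
(`ω = θ^{1−s}μ^{s}`, `C₉ = (32∕(s²·min(r∕2, γ∕2)))·(2C₅∕(1−θ))^{1−s}(2M)^{s}∕ω`), `0 < C₅`, `0 < θ < 1`, and at the bundle's level (P) + (A): a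
complex-differentiable extension of every young-coupling section on a set containing the CLOSED `r`-discs about `]0, γ]` with the sup letter
`M·μ^{age−1}·e^{−κd}` (`θ ≤ μ`, `2C₅∕(1−θ) ≤ 2M`, `0 < s < 1`) — via `YMDAG.N22.n22At_level_of_n18At_below_analytic`. [folklore] -/
theorem s_N22_of_s_N18_towerKeyed_analytic (RRec : RateRecordPred N) (h18 : S_N18 RRec)
    (hkey : ∀ (F : T4Family) (D : Datum F N) (g₀ : ℕ → ℝ) (os : List (ULoop F)) (R : RateCarriers N), RRec F D g₀ os R →
      ∃ (T : TowerData) (E : ℕ → (ℕ → ℝ) → T.B → T.Dom → ℝ) (γ κ θ C₅ M μ r s cr ρ' : ℝ) (k : ℕ),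
        R.u3 = ⟨T.level k, Window γ, γ, κ, E k, fun b g U X => E (k + 1) (prepend b g) U X, θ, C₅,
          fun a i => 32 / (s ^ 2 * min (r / 2) (γ / 2)) * ((2 * C₅ / (1 - θ)) ^ (1 - s) * (2 * M) ^ s) / (θ ^ (1 - s) * μ ^ s)
            * (θ ^ (1 - s) * μ ^ s) ^ (a - i),
          32 / (s ^ 2 * min (r / 2) (γ / 2)) * ((2 * C₅ / (1 - θ)) ^ (1 - s) * (2 * M) ^ s) / (θ ^ (1 - s) * μ ^ s),
          θ ^ (1 - s) * μ ^ s, cr, ρ'⟩ ∧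
        0 < C₅ ∧ 0 < θ ∧ θ < 1 ∧
        (∀ k' < k, ∃ (R' : RateCarriers N) (Λ' : ℕ → ℕ → ℝ) (C₉' ω' cr' ρ'' : ℝ), RRec F D g₀ os R' ∧
          R'.u3 = ⟨T.level k', Window γ, γ, κ, E k', fun b g U X => E (k' + 1) (prepend b g) U X, θ, C₅, Λ', C₉', ω', cr', ρ''⟩) ∧
        PrefixDependenceOn (C := T.level k) (E k) (Window γ) ∧
        (∀ g ∈ Window γ, ∀ (U : (T.level k).BgA) (X : (T.level k).Dom) (i : ℕ), i < (T.level k).scale X →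
          ∃ (Fz : ℂ → ℂ) (Dset : Set ℂ), DifferentiableOn ℂ Fz Dset ∧
            (∀ z ∈ Dset, ‖Fz z‖ ≤ M * μ ^ ((T.level k).scale X - 1 - i) * Real.exp (-(κ * (T.level k).d X))) ∧
            (∀ t ∈ Ioc (0 : ℝ) γ, closedBall (t : ℂ) r ⊆ Dset) ∧
            (∀ t ∈ Ioc (0 : ℝ) γ, Fz t = (E k (Function.update g i t) U X : ℂ))) ∧
        0 < M ∧ θ ≤ μ ∧ 2 * C₅ / (1 - θ) ≤ 2 * M ∧ 0 < r ∧ 0 < γ ∧ 0 < s ∧ s < 1) :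
    S_N22 RRec := by
  intro F D g₀ os R hR
  obtain ⟨T, E, γ, κ, θ, C₅, M, μ, r, s, cr, ρ', k, hu, hC, hθ0, hθ1, hlow, hP, hA, hM, hθμ, hCM, hr, hγ, hs0, hs1⟩ :=
    hkey F D g₀ os R hR
  rw [hu]
  exact n22At_level_of_n18At_below_analytic T E hC hθ0 hθ1 k (n18At_below_of_s_N18 h18 T E γ κ θ C₅ _ _ _ _ _ hlow) hP hA hM hθμ
    hCM hr hγ hs0 hs1

/-! ## §3 Cluster K4 at a tower-keyed home: N22's binder replaced by the regularity letter -/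

/-- **THE DEPENDENT NODE N17 AT A TOWER-KEYED HOME**: `S_D4 RRec → S_N18 RRec → (tower key + (R₂) letter) → S_N17 RRec` — the route's glue
`YMDAG.UVSplit.N17_of_U3edge` with its `S_N22` input DERIVED by `s_N22_of_s_N18_towerKeyed`. [folklore] -/
theorem s_N17_of_s_N18_towerKeyed (RRec : RateRecordPred N) (hD4 : S_D4 RRec) (h18 : S_N18 RRec)
    (hkey : ∀ (F : T4Family) (D : Datum F N) (g₀ : ℕ → ℝ) (os : List (ULoop F)) (R : RateCarriers N), RRec F D g₀ os R →
      ∃ (T : TowerData) (E : ℕ → (ℕ → ℝ) → T.B → T.Dom → ℝ) (γ κ θ C₅ M μ ρ τ cr ρ' : ℝ) (k : ℕ),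
        R.u3 = ⟨T.level k, Window γ, γ, κ, E k, fun b g U X => E (k + 1) (prepend b g) U X, θ, C₅,
          fun a i => (4 * (2 * C₅ / (1 - θ)) / γ + M * γ / 2) / τ * τ ^ (a - i), (4 * (2 * C₅ / (1 - θ)) / γ + M * γ / 2) / τ, τ, cr, ρ'⟩ ∧
        0 ≤ C₅ ∧ 0 ≤ θ ∧ θ < 1 ∧
        (∀ k' < k, ∃ (R' : RateCarriers N) (Λ' : ℕ → ℕ → ℝ) (C₉' ω' cr' ρ'' : ℝ), RRec F D g₀ os R' ∧
          R'.u3 = ⟨T.level k', Window γ, γ, κ, E k', fun b g U X => E (k' + 1) (prepend b g) U X, θ, C₅, Λ', C₉', ω', cr', ρ''⟩) ∧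
        PrefixDependenceOn (C := T.level k) (E k) (Window γ) ∧
        (∀ g ∈ Window γ, ∀ (U : (T.level k).BgA) (X : (T.level k).Dom) (i : ℕ), i < (T.level k).scale X →
          ∀ t d : ℝ, 0 < d → t - d ∈ Ioc (0 : ℝ) γ → t + d ∈ Ioc (0 : ℝ) γ →
            |E k (Function.update g i (t + d)) U X - 2 * E k (Function.update g i t) U X + E k (Function.update g i (t - d)) U X| ≤
              M * μ ^ ((T.level k).scale X - 1 - i) * Real.exp (-(κ * (T.level k).d X)) * d ^ 2) ∧
        0 ≤ M ∧ 0 ≤ μ ∧ 0 < γ ∧ 0 < ρ ∧ ρ ≤ 1 ∧ θ ≤ τ * ρ ∧ μ * ρ ≤ τ ∧ 0 < τ) :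
    S_N17 RRec :=
  N17_of_U3edge RRec hD4 h18 (s_N22_of_s_N18_towerKeyed RRec h18 hkey)

/-- **CLUSTER K4's JOIN AT A TOWER-KEYED HOME — SIX BINDERS AND N22's LETTER** (kernel): existence of the carriers of record under the pins (R00x),
the by-name stubs N14, N15, N16, N18, the tower key with (P) + the (R₂) letter, and the (D4) read-out binders give K4's conclusion hook
`SpineRates Rec (RateInputs RRec)` — the route's `YMDAG.UVSplit.SpineRates_of_glueN17` with `h22 := s_N22_of_s_N18_towerKeyed …` (and hence N17 glued
by `N17_of_U3edge`).  What N22 contributes to K4 at such a home is EXACTLY the regularity letter (W1's ∕ the history estimate's content); the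
oscillation input is node N18's stub. [folklore] -/
theorem spineRates_of_towerKeyed_glueN17 (Rec : RecordPred N) (RRec : RateRecordPred N) (hx : S_R00x Rec RRec) (h14 : S_N14 RRec)
    (h15 : S_N15 RRec) (h16 : S_N16 RRec) (h18 : S_N18 RRec)
    (hkey : ∀ (F : T4Family) (D : Datum F N) (g₀ : ℕ → ℝ) (os : List (ULoop F)) (R : RateCarriers N), RRec F D g₀ os R →
      ∃ (T : TowerData) (E : ℕ → (ℕ → ℝ) → T.B → T.Dom → ℝ) (γ κ θ C₅ M μ ρ τ cr ρ' : ℝ) (k : ℕ),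
        R.u3 = ⟨T.level k, Window γ, γ, κ, E k, fun b g U X => E (k + 1) (prepend b g) U X, θ, C₅,
          fun a i => (4 * (2 * C₅ / (1 - θ)) / γ + M * γ / 2) / τ * τ ^ (a - i), (4 * (2 * C₅ / (1 - θ)) / γ + M * γ / 2) / τ, τ, cr, ρ'⟩ ∧
        0 ≤ C₅ ∧ 0 ≤ θ ∧ θ < 1 ∧
        (∀ k' < k, ∃ (R' : RateCarriers N) (Λ' : ℕ → ℕ → ℝ) (C₉' ω' cr' ρ'' : ℝ), RRec F D g₀ os R' ∧
          R'.u3 = ⟨T.level k', Window γ, γ, κ, E k', fun b g U X => E (k' + 1) (prepend b g) U X, θ, C₅, Λ', C₉', ω', cr', ρ''⟩) ∧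
        PrefixDependenceOn (C := T.level k) (E k) (Window γ) ∧
        (∀ g ∈ Window γ, ∀ (U : (T.level k).BgA) (X : (T.level k).Dom) (i : ℕ), i < (T.level k).scale X →
          ∀ t d : ℝ, 0 < d → t - d ∈ Ioc (0 : ℝ) γ → t + d ∈ Ioc (0 : ℝ) γ →
            |E k (Function.update g i (t + d)) U X - 2 * E k (Function.update g i t) U X + E k (Function.update g i (t - d)) U X| ≤
              M * μ ^ ((T.level k).scale X - 1 - i) * Real.exp (-(κ * (T.level k).d X)) * d ^ 2) ∧
        0 ≤ M ∧ 0 ≤ μ ∧ 0 < γ ∧ 0 < ρ ∧ ρ ≤ 1 ∧ θ ≤ τ * ρ ∧ μ * ρ ≤ τ ∧ 0 < τ)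
    (hD4 : S_D4 RRec) : SpineRates Rec (RateInputs RRec) :=
  SpineRates_of_glueN17 Rec RRec hx h14 h15 h16 h18 (s_N22_of_s_N18_towerKeyed RRec h18 hkey) hD4

/-! ## §4 Non-vacuity of the key: a MODEL tower-keyed record carrying `S_N18`, hence `S_N22` by §2 (NOT NODE 00's record) -/

/-- **THE MODEL RECORD CARRIES NODE N18's STUB**: for every tower of carriers `T`, the predicate «the U3 bundle of `R` is SOME level of `T` with ZERO
level functionals, window `Window 1`, decay `0`, NE5 letters `θ = 1∕2`, `C₅ = 1`» (any fixed history letters) carries `S_N18` — `|0 − 0| ≤ 1·(1∕2)^{scale}·e^{0}`.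
A MODEL record (K4's letters exercised), NOT NODE 00's. [folklore] -/
theorem s_N18_toyTowerRecord (T : TowerData) (Λ : ℕ → ℕ → ℝ) (C₉ ω cr ρ : ℝ) :
    S_N18 (N := N) (fun _ _ _ _ R => ∃ k : ℕ,
      R.u3 = ⟨T.level k, Window 1, 1, 0, fun _ _ _ => 0, fun _ _ _ _ => 0, 1 / 2, 1, Λ, C₉, ω, cr, ρ⟩) := by
  rintro F D g₀ os R ⟨k, hu⟩
  rw [hu]
  intro b _ _ g _ U X
  show |(0 : ℝ) - 0| ≤ 1 * (1 / 2) ^ (T.level k).scale X * Real.exp (-(0 * (T.level k).d X))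
  rw [sub_self, abs_zero, zero_mul, neg_zero, Real.exp_zero, mul_one, one_mul]
  positivity

/-- **THE MODEL RECORD IS TOWER-KEYED, HENCE CARRIES NODE N22's STUB BY §2.**  The predicate «`R.u3` is a level of `T` with zero functionals and the §2
letters at `C₅ = 1`, `θ = 1∕2`, `γ = 1`, `κ = 0`, `M = μ = 0`, `ρ = 1`, `τ = 1∕2`, `cr = 0`, `ρ′ = 1`» satisfies the tower key (each lower level `k′` is
the bundle of the record `{R with u3 := level k′}`), (P) and (R₂) trivially (zero sections), and `S_N18` (`s_N18_toyTowerRecord`); so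
`s_N22_of_s_N18_towerKeyed` FIRES and gives `S_N22` — the key, the letter and node N18's stub are jointly satisfiable (referee standard A5).
A MODEL record, NOT NODE 00's. [folklore] -/
theorem s_N22_toyTowerRecord (T : TowerData) :
    S_N22 (N := N) (fun _ _ _ _ R => ∃ k : ℕ,
      R.u3 = ⟨T.level k, Window 1, 1, 0, fun _ _ _ => 0, fun _ _ _ _ => 0, 1 / 2, 1,
        fun a i => (4 * (2 * 1 / (1 - 1 / 2)) / 1 + 0 * 1 / 2) / (1 / 2) * (1 / 2) ^ (a - i),
        (4 * (2 * 1 / (1 - 1 / 2)) / 1 + 0 * 1 / 2) / (1 / 2), 1 / 2, 0, 1⟩) := by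
  refine s_N22_of_s_N18_towerKeyed _ (s_N18_toyTowerRecord T _ _ _ _ _) ?_
  rintro F D g₀ os R ⟨k, hu⟩
  refine ⟨T, fun _ _ _ _ => 0, 1, 0, 1 / 2, 1, 0, 0, 1, 1 / 2, 0, 1, k, hu, zero_le_one, by norm_num, by norm_num, ?_, ?_, ?_,
    le_rfl, le_rfl, one_pos, one_pos, le_rfl, by norm_num, by norm_num, by norm_num⟩
  · intro k' _
    exact ⟨{ R with u3 := ⟨T.level k', Window 1, 1, 0, fun _ _ _ => 0, fun _ _ _ _ => 0, 1 / 2, 1,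
        fun a i => (4 * (2 * 1 / (1 - 1 / 2)) / 1 + 0 * 1 / 2) / (1 / 2) * (1 / 2) ^ (a - i),
        (4 * (2 * 1 / (1 - 1 / 2)) / 1 + 0 * 1 / 2) / (1 / 2), 1 / 2, 0, 1⟩ },
      fun a i => (4 * (2 * 1 / (1 - 1 / 2)) / 1 + 0 * 1 / 2) / (1 / 2) * (1 / 2) ^ (a - i),
      (4 * (2 * 1 / (1 - 1 / 2)) / 1 + 0 * 1 / 2) / (1 / 2), 1 / 2, 0, 1, ⟨k', rfl⟩, rfl⟩
  · intro g _ g' _ U X _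
    rfl
  · intro g _ U X i _ t d _ _ _
    show |(0 : ℝ) - 2 * 0 + 0| ≤ 0 * 0 ^ ((T.level k).scale X - 1 - i) * Real.exp (-(0 * (T.level k).d X)) * d ^ 2
    simp

end YMDAG.N22

end
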